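import Summits.ABC.IUTFork.Cor312ThetaSideSlotTransportK
import Literature.IUT.LogVolume.GenuineLogThetaPerImageExactVolume
import HarnessLib

/-!
# [IUTchIII] Cor. 3.12 IN READING (P) at the `K`-level sharp setting — the `K`-level LAST-slot contents ARE the genuine per-image contents:
# the EXACT content of the LAST-slot box at every tuple of places of `K`, and the genuine per-image local term as a function of the contents

PROOF-ONLY file (D-0012; no definitions, no `Prop` facts) of the abc-iut cell (R2 S-chain team, seat abc-iut-s2-p7 gen 3, CLAIM «HΘP-K»: the READ-P
binder of abc-iut-C-cert-2's γ certificate, p458998). TAKES NO SIDE on [IUTchIII] Cor. 3.12 or on the reading (U)/(P) of `−|log(Θ)|`. The reading-(P)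
twin of abc-iut-s2-p6's `Cor312ThetaSideContentExactK` (p448377: the slot UNION; here the LAST-slot box alone, which is what the (Ind2)-slot hull reads).

* (`Cor312Vol` / `Cor312Prov`) `lastSlot_subset_smul_logPacket_iff_factorIso`, `lastSlot_subset_iff_section`,
  **`content_lastSlot_eq_perImageContentFamily_below`** — the EXACT content of the `K`-level LAST-slot box `ι_{i+1}(t_{i,e_last})·(R_e)^∼` at every tuple
  `e` of places of `K` is abc-iut-S2's genuine PER-IMAGE content at the section tuple below `e` (single-slot transport along the isometric
  `K_{v̲_a} ≃ K_{e_a}` of `K/F_mod` Galois, abc-iut-w5-d056; this seat's gen-2 `image_factorAlgEquiv_iota_smul_normalizedPacket` /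
  `iota_smul_normalizedPacket_eq_of_norm_eq_sameSlot`; the (U)-twin is abc-iut-s2-p6's `content_slotUnion_eq_contentFamily_below`, p448377);
  `exists_perImageContentFamily`, `negLogThetaPerImageLoc_eq_of_perImageContent` (abc-iut-s2-p2 `realPrimePacketWith_negLogThetaPerImageAt_eq_of_content`);
USE (sequel `Cor312ThetaSlotExactK`): per prime the `Pr_K`-weighted last-slot content-hull sum descends to `I.negLogThetaPerImageLoc p` (abc-iut-w5-d056),
whence `negLogThetaSlot (settingPrVolSharp (pilotDataOfK D K) …) = ↑I.negLogThetaPerImageNonarch ≤ ↑I.negLogThetaPerImage` — the READ-P binder `hReadP` of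
abc-iut-C-cert-2's γ certificate `Conditional.abc_of_slotLicence_orNumP_K_szpiroBad` (p458998).
[cite: Mochizuki2012, IUTchIII Cor. 3.12 p. 173–174, proof Step (x) p. 181; Thm. 3.11 (i) (Ind2) p. 154] [cite: Mochizuki2012, IUTchIV Thm. 1.10 Steps
(v)–(viii) p. 27–31] [cite: Mochizuki2012, IUTchI Rmk. 3.1.5 p. 65] [cite: DupuyHilado2025, Def. 3.6.3, §3.9, §4.9, §4.11–4.12] [cite: WeilBNT1967, Ch. II
§2, Th. 2] [claim: Mochizuki2012, status: disputed] for every quoted construction. HONEST FRAMING: identities between OUR typed objects; reading (P) is STRONGER than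
print's hull of the union; nothing here asserts or denies Cor. 3.12 for any initial Θ-data or takes a side on any author; typed ≠ proved; instantiated ≠ endorsed.
-/

noncomputable section

open Set Function NumberField IsDedekindDomain
open scoped Pointwise

/-! ## The exact LAST-slot content at every tuple of places of `K` is the genuine per-image content below it -/

namespace Summit.ABC.IUTFork.Cor312Vol

open Literature.IUT.LogVolume

section Generic

variable (p : ℕ) [hp : Fact p.Prime] {I : Type} [Fintype I] [DecidableEq I] [Nonempty I]
  (k : I → Type) [∀ i, NontriviallyNormedField (k i)] [∀ i, NormedAlgebra ℚ_[p] (k i)]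
  [∀ i, IsUltrametricDist (k i)] [∀ i, ProperSpace (k i)]
  (k' : I → Type) [∀ i, NontriviallyNormedField (k' i)] [∀ i, NormedAlgebra ℚ_[p] (k' i)]
  [∀ i, IsUltrametricDist (k' i)] [∀ i, ProperSpace (k' i)]
  (φ : ∀ i, k i ≃ₐ[ℚ_[p]] k' i)

/-- **The content bracket of ONE slot box is INVARIANT along factorwise isometric isomorphisms (both directions)**: for `‖x'‖ = ‖x‖ ≠ 0` in the
slot `a` and any scalar `c ∈ ℚ_p`, `ι_a(x)·(R_I)^∼ ⊆ c·log_p(R_I^×) ⟺ ι_a(x')·(R'_I)^∼ ⊆ c·log_p(R'_I^×)` (gen-2 `image_factorAlgEquiv_iota_smul_normalizedPacket`,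
`iota_smul_normalizedPacket_eq_of_norm_eq_sameSlot`, abc-iut-w5-d056 `image_const_smul_factor` / `image_logPacket_factor`; the slot-union form is
abc-iut-s2-p6's `slotUnion_subset_smul_logPacket_iff_factorIso`). [cite: DupuyHilado2025, §4.7, §4.12] [cite: Mochizuki2012, IUTchIV Prop. 1.2 p. 10] -/
theorem lastSlot_subset_smul_logPacket_iff_factorIso (hφ : ∀ i (x : k i), ‖φ i x‖ = ‖x‖) (a : I) (x : k a) (x' : k' a)
    (hx : x ≠ 0) (hxx' : ‖x'‖ = ‖x‖) (c : ℚ_[p]) :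
    iota p k a x • (normalizedPacket p k : Set (PacketAlgebra p k)) ⊆ c • (logPacket p k : Set (PacketAlgebra p k)) ↔
      iota p k' a x' • (normalizedPacket p k' : Set (PacketAlgebra p k')) ⊆ c • (logPacket p k' : Set (PacketAlgebra p k')) := by
  rw [← image_subset_image_iff (factorAlgEquiv p k k' φ).injective, image_factorAlgEquiv_iota_smul_normalizedPacket,
    ← iota_smul_normalizedPacket_eq_of_norm_eq_sameSlot p k' a (u := φ a x) (u' := x') ((map_ne_zero (φ a)).mpr hx)
      (by rw [hφ]; exact hxx'),
    image_const_smul_factor, image_logPacket_factor p k k' φ hφ]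

end Generic

end Summit.ABC.IUTFork.Cor312Vol

namespace Summit.ABC.IUTFork.Cor312Prov

open Cor312 Cor312Vol Literature.IUT.LogThetaLattice Literature.IUT.LogVolume
  Literature.IUT.HodgeTheaters Literature.IUT.LogVolume.ThetaData Literature.NumberTheory.NumberFields
open Thm311.Real hiding finBelow

section Input

variable {F₀ : Type} [Field F₀] [NumberField F₀] {K : Type} [Field K] [NumberField K] [Algebra F₀ K] (I : ThetaVolumeInput F₀ K)

/-- **A PER-IMAGE content family EXISTS for every genuine input**: at every prime `p`, label `i+1` and tuple `v⃗`, the LAST-slot box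
`ι_{i+1}(t_{Θ,i,v_{i+1}})·(R_I)^∼` is `ψ`-bounded and contains the non-zero vector `ι_{i+1}(t)`, so it has an exact content (abc-iut-c312-3 `exists_content`,
abc-iut-s2-p2 `exists_ne_zero_mem_lastSlot`); the value at a non-prime index is irrelevant and set to `0`. [cite: WeilBNT1967, Ch. II §2, Th. 2]
[cite: DupuyHilado2025, §3.9, §4.12] -/
theorem exists_perImageContentFamily :
    ∃ m : (p : ℕ) → (i : Fin I.lstar) → (Fin ((i : ℕ) + 1 + 1) → placesOver F₀ p) → ℤ,
      ∀ (p : ℕ) [hp : Fact p.Prime] (i : Fin I.lstar) (e : Fin ((i : ℕ) + 1 + 1) → placesOver F₀ p),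
      iota p (fun b => (I.σ.localFieldFamily p hp.out).k (e b)) (Fin.last _)
            (I.tΘ p hp.out i (e (Fin.last _)) : (I.σ.localFieldFamily p hp.out).k (e (Fin.last _))) •
          (normalizedPacket p (fun b => (I.σ.localFieldFamily p hp.out).k (e b)) :
            Set (PacketAlgebra p (fun b => (I.σ.localFieldFamily p hp.out).k (e b)))) ⊆
        ((p : ℚ_[p]) ^ m p i e) • (logPacket p (fun b => (I.σ.localFieldFamily p hp.out).k (e b)) :
            Set (PacketAlgebra p (fun b => (I.σ.localFieldFamily p hp.out).k (e b)))) ∧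
      ¬ iota p (fun b => (I.σ.localFieldFamily p hp.out).k (e b)) (Fin.last _)
            (I.tΘ p hp.out i (e (Fin.last _)) : (I.σ.localFieldFamily p hp.out).k (e (Fin.last _))) •
          (normalizedPacket p (fun b => (I.σ.localFieldFamily p hp.out).k (e b)) :
            Set (PacketAlgebra p (fun b => (I.σ.localFieldFamily p hp.out).k (e b)))) ⊆
        ((p : ℚ_[p]) ^ (m p i e + 1)) • (logPacket p (fun b => (I.σ.localFieldFamily p hp.out).k (e b)) :
            Set (PacketAlgebra p (fun b => (I.σ.localFieldFamily p hp.out).k (e b)))) := by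
  classical
  have h : ∀ (p : ℕ) (hp : p.Prime) (i : Fin I.lstar) (e : Fin ((i : ℕ) + 1 + 1) → placesOver F₀ p), ∃ m : ℤ,
      haveI : Fact p.Prime := ⟨hp⟩
      iota p (fun b => (I.σ.localFieldFamily p hp).k (e b)) (Fin.last _)
            (I.tΘ p hp i (e (Fin.last _)) : (I.σ.localFieldFamily p hp).k (e (Fin.last _))) •
          (normalizedPacket p (fun b => (I.σ.localFieldFamily p hp).k (e b)) :
            Set (PacketAlgebra p (fun b => (I.σ.localFieldFamily p hp).k (e b)))) ⊆
        ((p : ℚ_[p]) ^ m) • (logPacket p (fun b => (I.σ.localFieldFamily p hp).k (e b)) :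
            Set (PacketAlgebra p (fun b => (I.σ.localFieldFamily p hp).k (e b)))) ∧
      ¬ iota p (fun b => (I.σ.localFieldFamily p hp).k (e b)) (Fin.last _)
            (I.tΘ p hp i (e (Fin.last _)) : (I.σ.localFieldFamily p hp).k (e (Fin.last _))) •
          (normalizedPacket p (fun b => (I.σ.localFieldFamily p hp).k (e b)) :
            Set (PacketAlgebra p (fun b => (I.σ.localFieldFamily p hp).k (e b)))) ⊆
        ((p : ℚ_[p]) ^ (m + 1)) • (logPacket p (fun b => (I.σ.localFieldFamily p hp).k (e b)) :
            Set (PacketAlgebra p (fun b => (I.σ.localFieldFamily p hp).k (e b)))) := by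
    intro p hp i e
    haveI : Fact p.Prime := ⟨hp⟩
    exact exists_content p (fun b => (I.σ.localFieldFamily p hp).k (e b)) (isPsiBounded_smul_normalizedPacket p _ _)
      (exists_ne_zero_mem_lastSlot p (I.σ.localFieldFamily p hp) (I.tΘ p hp) i e)
  refine ⟨fun p i e => if hp : p.Prime then (h p hp i e).choose else 0, ?_⟩
  intro p hp i e
  have hp' : p.Prime := hp.out
  have hspec := (h p hp' i e).choose_spec
  simp only [dif_pos hp']
  exact hspec

/-- **The genuine PER-IMAGE local term IS an affine function of the last-slot contents** (input-level wrapper of abc-iut-s2-p2's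
`realPrimePacketWith_negLogThetaPerImageAt_eq_of_content`): at a prime `p`, for any family `m(i,v⃗)` of exact contents of the last-slot boxes,
`negLogThetaPerImageLoc I p = (1/ℓ⋇)·Σ_i Σ_{v⃗} (−m(i,v⃗)·log p + log μ̄(hull(log_p(R_{v⃗}^×))))·Π_b Pr(v_b)`. [cite: Mochizuki2012, IUTchIII Cor. 3.12 proof
Step (x) p. 181] [cite: DupuyHilado2025, Def. 3.6.3, §4.12] -/
theorem negLogThetaPerImageLoc_eq_of_perImageContent (p : ℕ) [hp : Fact p.Prime]
    (m : (i : Fin I.lstar) → (Fin ((i : ℕ) + 1 + 1) → placesOver F₀ p) → ℤ)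
    (hm : ∀ (i : Fin I.lstar) (e : Fin ((i : ℕ) + 1 + 1) → placesOver F₀ p),
      iota p (fun b => (I.σ.localFieldFamily p hp.out).k (e b)) (Fin.last _)
            (I.tΘ p hp.out i (e (Fin.last _)) : (I.σ.localFieldFamily p hp.out).k (e (Fin.last _))) •
          (normalizedPacket p (fun b => (I.σ.localFieldFamily p hp.out).k (e b)) :
            Set (PacketAlgebra p (fun b => (I.σ.localFieldFamily p hp.out).k (e b)))) ⊆
        ((p : ℚ_[p]) ^ m i e) • (logPacket p (fun b => (I.σ.localFieldFamily p hp.out).k (e b)) :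
            Set (PacketAlgebra p (fun b => (I.σ.localFieldFamily p hp.out).k (e b)))) ∧
      ¬ iota p (fun b => (I.σ.localFieldFamily p hp.out).k (e b)) (Fin.last _)
            (I.tΘ p hp.out i (e (Fin.last _)) : (I.σ.localFieldFamily p hp.out).k (e (Fin.last _))) •
          (normalizedPacket p (fun b => (I.σ.localFieldFamily p hp.out).k (e b)) :
            Set (PacketAlgebra p (fun b => (I.σ.localFieldFamily p hp.out).k (e b)))) ⊆
        ((p : ℚ_[p]) ^ (m i e + 1)) • (logPacket p (fun b => (I.σ.localFieldFamily p hp.out).k (e b)) :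
            Set (PacketAlgebra p (fun b => (I.σ.localFieldFamily p hp.out).k (e b))))) :
    I.negLogThetaPerImageLoc p =
      (1 / (I.lstar : ℝ)) * ∑ i : Fin I.lstar, ∑ e : Fin ((i : ℕ) + 1 + 1) → placesOver F₀ p,
        (-(m i e * Real.log p) + packetLogμ p (fun b => (I.σ.localFieldFamily p hp.out).k (e b))
          (packetHull p (fun b => (I.σ.localFieldFamily p hp.out).k (e b))
            (logPacket p (fun b => (I.σ.localFieldFamily p hp.out).k (e b)) :
              Set (PacketAlgebra p (fun b => (I.σ.localFieldFamily p hp.out).k (e b)))))) *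
          ∏ b, weight F₀ (e b).1 := by
  rw [I.negLogThetaPerImageLoc_of_prime hp.out]
  exact realPrimePacketWith_negLogThetaPerImageAt_eq_of_content p (I.σ.localFieldFamily p hp.out)
    (mScale p (I.σ.localFieldFamily p hp.out)) (mScale_ne_zero p (I.σ.localFieldFamily p hp.out))
    (mScale_perm p (I.σ.localFieldFamily p hp.out)) (I.tΘ p hp.out) m hm

end Input

variable {F K Fbar : Type} [Field F] [NumberField F] [Field K] [NumberField K] [Algebra F K] [Field Fbar]
  [Algebra F Fbar] [Algebra K Fbar] {E : WeierstrassCurve F} [E.IsElliptic] {l : ℕ} {Pb : BadPlacePredicates K}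
  (D : InitialThetaData F K Fbar E l Pb)
  (t : ∀ (pp : Nat.Primes) (_ : Fin (pilotDataOfK D K).lstar) (x : (thetaIndex (pilotDataOfK D K)).Fibre (.inr pp)),
    haveI : Fact (pp : ℕ).Prime := ⟨pp.2⟩; kOf (pilotDataOfK D K) pp.1 x)

/-- **The content bracket of the `K`-level LAST-slot box at a tuple `e` of places of `K` IFF the genuine one at the section tuple below `e`.**
For initial Θ-data `D` with idele data `r`, ANY realising Θ-idele `t` over `K` (`ht0`, `hT`), a tuple `e : S^±_{i+2} → 𝕍(K)_p` and `m ∈ ℤ`: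
`ι_{i+1}(t_{i,e_last})·(R_e)^∼ ⊆ p^m·log_p(R_e^×)` in abc-iut-c312-5's summand `X_e` ⟺ `ι_{i+1}(t_{Θ,i,v_last})·(R_{v̲⃗})^∼ ⊆ p^m·log_p(R_{v̲⃗}^×)` in abc-iut-S2's
genuine packet at the section tuple `v̲⃗` below `e` (`K/F_mod` Galois, [IUTchI] Rmk. 3.1.5; isometric `K_{v̲_a} ≃ K_{e_a}`, abc-iut-w5-d056
`RescaledCompletion.exists_algEquiv_norm_eq_of_under_eq`; `‖t_{i,e_a}‖ = ‖t_{Θ,i,v_a}‖`, gen-2 `norm_eq_norm_tΘ_of_realising`) — the single-slot twin of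
abc-iut-s2-p6's `slotUnion_subset_iff_section`. [cite: Mochizuki2012, IUTchI Rmk. 3.1.5 p. 65] [cite: CasselsFrohlichANT1967, Ch. VII Prop. 1.2 (ii)]
[cite: DupuyHilado2025, §3.9, §4.12] -/
theorem lastSlot_subset_iff_section {logv : PadicLogs K} (hlog : LogvAnalytic logv)
    (r : IdeleData D) (ht0 : ∀ pp i x, t pp i x ≠ 0)
    (hT : ∀ (pp : Nat.Primes) (i : Fin (pilotDataOfK D K).lstar) (x : (thetaIndex (pilotDataOfK D K)).Fibre (.inr pp)),
      haveI : Fact (pp : ℕ).Prime := ⟨pp.2⟩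
      Real.log ‖t pp i x‖ = -((pilotDataOfK D K).thetaPilot i (placeOf (pilotDataOfK D K) pp.1 x)) *
        logNorm K (placeOf (pilotDataOfK D K) pp.1 x) / localDegree K (placeOf (pilotDataOfK D K) pp.1 x))
    (pp : Nat.Primes) (i : Fin (thetaIndex (pilotDataOfK D K)).lstar)
    (e : (thetaIndex (pilotDataOfK D K)).Caps (Setting.labelSucc i) → (thetaIndex (pilotDataOfK D K)).Fibre (.inr pp)) (m : ℤ) :
    haveI : Fact (pp : ℕ).Prime := ⟨pp.2⟩
    iota pp.1 ((presAt (pilotDataOfK D K) hlog pp).kk e) (Fin.last _) (t pp i (e (Fin.last _))) •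
        (normalizedPacket pp.1 ((presAt (pilotDataOfK D K) hlog pp).kk e) :
          Set ((presAt (pilotDataOfK D K) hlog pp).X e)) ⊆
      (((pp : ℕ) : ℚ_[pp]) ^ m) •
        (logPacket pp.1 ((presAt (pilotDataOfK D K) hlog pp).kk e) : Set ((presAt (pilotDataOfK D K) hlog pp).X e)) ↔
    iota pp.1 (fun b => ((volumeInputOf D r).σ.localFieldFamily pp.1 pp.2).k
            ⟨finBelow (fieldOfModuli E) K (placeOf (pilotDataOfK D K) pp.1 (e b)),
              finBelow_mem_placesOver (fieldOfModuli E) K (placeOf_mem (pilotDataOfK D K) pp.1 (e b))⟩) (Fin.last _)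
          ((volumeInputOf D r).tΘ pp.1 pp.2 i
              ⟨finBelow (fieldOfModuli E) K (placeOf (pilotDataOfK D K) pp.1 (e (Fin.last _))),
                finBelow_mem_placesOver (fieldOfModuli E) K (placeOf_mem (pilotDataOfK D K) pp.1 (e (Fin.last _)))⟩ :
            ((volumeInputOf D r).σ.localFieldFamily pp.1 pp.2).k
              ⟨finBelow (fieldOfModuli E) K (placeOf (pilotDataOfK D K) pp.1 (e (Fin.last _))),
                finBelow_mem_placesOver (fieldOfModuli E) K (placeOf_mem (pilotDataOfK D K) pp.1 (e (Fin.last _)))⟩) •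
        (normalizedPacket pp.1 (fun b => ((volumeInputOf D r).σ.localFieldFamily pp.1 pp.2).k
            ⟨finBelow (fieldOfModuli E) K (placeOf (pilotDataOfK D K) pp.1 (e b)),
              finBelow_mem_placesOver (fieldOfModuli E) K (placeOf_mem (pilotDataOfK D K) pp.1 (e b))⟩) :
          Set (PacketAlgebra pp.1 (fun b => ((volumeInputOf D r).σ.localFieldFamily pp.1 pp.2).k
            ⟨finBelow (fieldOfModuli E) K (placeOf (pilotDataOfK D K) pp.1 (e b)),
              finBelow_mem_placesOver (fieldOfModuli E) K (placeOf_mem (pilotDataOfK D K) pp.1 (e b))⟩))) ⊆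
      (((pp : ℕ) : ℚ_[pp]) ^ m) •
        (logPacket pp.1 (fun b => ((volumeInputOf D r).σ.localFieldFamily pp.1 pp.2).k
            ⟨finBelow (fieldOfModuli E) K (placeOf (pilotDataOfK D K) pp.1 (e b)),
              finBelow_mem_placesOver (fieldOfModuli E) K (placeOf_mem (pilotDataOfK D K) pp.1 (e b))⟩) :
          Set (PacketAlgebra pp.1 (fun b => ((volumeInputOf D r).σ.localFieldFamily pp.1 pp.2).k
            ⟨finBelow (fieldOfModuli E) K (placeOf (pilotDataOfK D K) pp.1 (e b)),
              finBelow_mem_placesOver (fieldOfModuli E) K (placeOf_mem (pilotDataOfK D K) pp.1 (e b))⟩))) := by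
  haveI : Fact (pp : ℕ).Prime := ⟨pp.2⟩
  haveI : IsGalois (fieldOfModuli E) K := D.isGalois_fieldOfModuli_K
  -- the section tuple below `e`
  let v : (thetaIndex (pilotDataOfK D K)).Caps (Setting.labelSucc i) → placesOver (fieldOfModuli E) pp.1 := fun b =>
    ⟨finBelow (fieldOfModuli E) K (placeOf (pilotDataOfK D K) pp.1 (e b)),
      finBelow_mem_placesOver (fieldOfModuli E) K (placeOf_mem (pilotDataOfK D K) pp.1 (e b))⟩
  have hunder : ∀ b, ((placeSection D).lift (v b).1).under (𝓞 (fieldOfModuli E)) =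
      (placeOf (pilotDataOfK D K) pp.1 (e b)).under (𝓞 (fieldOfModuli E)) := fun b => by
    rw [(placeSection D).under_lift, ← finBelow_eq_under (fieldOfModuli E) K]
  -- `K/F_mod` Galois: isometric `K_{v̲_b} ≃ₐ[ℚ_p] K_{e_b}` for every slot
  choose φ hφ using fun b => RescaledCompletion.exists_algEquiv_norm_eq_of_under_eq (F₀ := fieldOfModuli E) (p := pp.1)
    ((placeSection D).lift (v b).1) (placeOf (pilotDataOfK D K) pp.1 (e b)) ((placeSection D).natCast_mem_lift (v b))
    (natCast_mem_placeOf (pilotDataOfK D K) pp.1 (e b)) (hunder b)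
  exact (Cor312Vol.lastSlot_subset_smul_logPacket_iff_factorIso pp.1
    (fun b => ((volumeInputOf D r).σ.localFieldFamily pp.1 pp.2).k (v b)) ((presAt (pilotDataOfK D K) hlog pp).kk e)
    φ hφ (Fin.last _) ((volumeInputOf D r).tΘ pp.1 pp.2 i (v (Fin.last _)) : ((volumeInputOf D r).σ.localFieldFamily pp.1 pp.2).k (v (Fin.last _)))
    (t pp i (e (Fin.last _))) (Units.ne_zero _) (norm_eq_norm_tΘ_of_realising D t r ht0 hT pp i (e (Fin.last _))) _).symm

/-- **The EXACT content of the `K`-level LAST-slot box at every tuple of places of `K` is the genuine PER-IMAGE content below it.** With `m_P` a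
per-image content family of the genuine input `volumeInputOf D r` (the binder shape of `exists_perImageContentFamily`), at every prime `p`, label
`i+1` and tuple `e : S^±_{i+2} → 𝕍(K)_p`, the last-slot box `ι_{i+1}(t_{i,e_last})·(R_e)^∼` of ANY realising Θ-idele `t` over `K` lies in
`p^{m_P(p,i,v⃗(e))}·log_p(R_e^×)` and NOT in `p^{m_P(p,i,v⃗(e))+1}·log_p(R_e^×)` — the input of the EQUALITY `thetaSlotLocal_settingPrVolSharp_eq_sum_content_hull`
at the `K`-level setting. [cite: DupuyHilado2025, §3.9, §4.12] [cite: Mochizuki2012, IUTchIII Cor. 3.12 proof Step (x) p. 181] [cite: WeilBNT1967, Ch. II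
§2, Th. 2] -/
theorem content_lastSlot_eq_perImageContentFamily_below {logv : PadicLogs K} (hlog : LogvAnalytic logv) (r : IdeleData D)
    (mP : (p : ℕ) → (i : Fin (volumeInputOf D r).lstar) → (Fin ((i : ℕ) + 1 + 1) → placesOver (fieldOfModuli E) p) → ℤ)
    (hmP : ∀ (p : ℕ) [hp : Fact p.Prime] (i : Fin (volumeInputOf D r).lstar) (e : Fin ((i : ℕ) + 1 + 1) → placesOver (fieldOfModuli E) p),
      iota p (fun b => ((volumeInputOf D r).σ.localFieldFamily p hp.out).k (e b)) (Fin.last _)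
            ((volumeInputOf D r).tΘ p hp.out i (e (Fin.last _)) : ((volumeInputOf D r).σ.localFieldFamily p hp.out).k (e (Fin.last _))) •
          (normalizedPacket p (fun b => ((volumeInputOf D r).σ.localFieldFamily p hp.out).k (e b)) :
            Set (PacketAlgebra p (fun b => ((volumeInputOf D r).σ.localFieldFamily p hp.out).k (e b)))) ⊆
        ((p : ℚ_[p]) ^ mP p i e) • (logPacket p (fun b => ((volumeInputOf D r).σ.localFieldFamily p hp.out).k (e b)) :
            Set (PacketAlgebra p (fun b => ((volumeInputOf D r).σ.localFieldFamily p hp.out).k (e b)))) ∧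
      ¬ iota p (fun b => ((volumeInputOf D r).σ.localFieldFamily p hp.out).k (e b)) (Fin.last _)
            ((volumeInputOf D r).tΘ p hp.out i (e (Fin.last _)) : ((volumeInputOf D r).σ.localFieldFamily p hp.out).k (e (Fin.last _))) •
          (normalizedPacket p (fun b => ((volumeInputOf D r).σ.localFieldFamily p hp.out).k (e b)) :
            Set (PacketAlgebra p (fun b => ((volumeInputOf D r).σ.localFieldFamily p hp.out).k (e b)))) ⊆
        ((p : ℚ_[p]) ^ (mP p i e + 1)) • (logPacket p (fun b => ((volumeInputOf D r).σ.localFieldFamily p hp.out).k (e b)) :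
            Set (PacketAlgebra p (fun b => ((volumeInputOf D r).σ.localFieldFamily p hp.out).k (e b)))))
    (ht0 : ∀ pp i x, t pp i x ≠ 0)
    (hT : ∀ (pp : Nat.Primes) (i : Fin (pilotDataOfK D K).lstar) (x : (thetaIndex (pilotDataOfK D K)).Fibre (.inr pp)),
      haveI : Fact (pp : ℕ).Prime := ⟨pp.2⟩
      Real.log ‖t pp i x‖ = -((pilotDataOfK D K).thetaPilot i (placeOf (pilotDataOfK D K) pp.1 x)) *
        logNorm K (placeOf (pilotDataOfK D K) pp.1 x) / localDegree K (placeOf (pilotDataOfK D K) pp.1 x))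
    (pp : Nat.Primes) (i : Fin (thetaIndex (pilotDataOfK D K)).lstar)
    (e : (thetaIndex (pilotDataOfK D K)).Caps (Setting.labelSucc i) → (thetaIndex (pilotDataOfK D K)).Fibre (.inr pp)) :
    haveI : Fact (pp : ℕ).Prime := ⟨pp.2⟩
    iota pp.1 ((presAt (pilotDataOfK D K) hlog pp).kk e) (Fin.last _) (t pp i (e (Fin.last _))) •
        (normalizedPacket pp.1 ((presAt (pilotDataOfK D K) hlog pp).kk e) :
          Set ((presAt (pilotDataOfK D K) hlog pp).X e)) ⊆
      (((pp : ℕ) : ℚ_[pp]) ^ mP pp.1 i (fun b =>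
          ⟨finBelow (fieldOfModuli E) K (placeOf (pilotDataOfK D K) pp.1 (e b)),
            finBelow_mem_placesOver (fieldOfModuli E) K (placeOf_mem (pilotDataOfK D K) pp.1 (e b))⟩)) •
        (logPacket pp.1 ((presAt (pilotDataOfK D K) hlog pp).kk e) : Set ((presAt (pilotDataOfK D K) hlog pp).X e)) ∧
    ¬ iota pp.1 ((presAt (pilotDataOfK D K) hlog pp).kk e) (Fin.last _) (t pp i (e (Fin.last _))) •
        (normalizedPacket pp.1 ((presAt (pilotDataOfK D K) hlog pp).kk e) :
          Set ((presAt (pilotDataOfK D K) hlog pp).X e)) ⊆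
      (((pp : ℕ) : ℚ_[pp]) ^ (mP pp.1 i (fun b =>
          ⟨finBelow (fieldOfModuli E) K (placeOf (pilotDataOfK D K) pp.1 (e b)),
            finBelow_mem_placesOver (fieldOfModuli E) K (placeOf_mem (pilotDataOfK D K) pp.1 (e b))⟩) + 1)) •
        (logPacket pp.1 ((presAt (pilotDataOfK D K) hlog pp).kk e) : Set ((presAt (pilotDataOfK D K) hlog pp).X e)) := by
  haveI : Fact (pp : ℕ).Prime := ⟨pp.2⟩
  have h := hmP pp.1 i (fun b => ⟨finBelow (fieldOfModuli E) K (placeOf (pilotDataOfK D K) pp.1 (e b)),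
    finBelow_mem_placesOver (fieldOfModuli E) K (placeOf_mem (pilotDataOfK D K) pp.1 (e b))⟩)
  exact ⟨(lastSlot_subset_iff_section D t hlog r ht0 hT pp i e _).mpr h.1,
    fun h' => h.2 ((lastSlot_subset_iff_section D t hlog r ht0 hT pp i e _).mp h')⟩

end Summit.ABC.IUTFork.Cor312Prov


end
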